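import Mathlib
import Literature.Computability.Complexity.ACFourierTails
import Literature.Computability.Complexity.FourierTails
import Literature.Computability.Complexity.CircuitRestriction
import HarnessLib

/-!
# Crux `MobiusLadder.LiouvilleOrthogonalTC0` (stmt-QuantumAdvantage-1393), line `Sketch`, skeleton v7:
# stub `stub_acInfluence` — total influence of shallow `acBasis` circuits

For a circuit `G` over `acBasis` (unbounded fan-in `∧/∨`, negations free in `acDepth`) on `n` bits with
`acDepth ≤ d` and at most `s ≥ 1` gates, the number of pairs (point, sensitive coordinate) satisfies
`Σ_i #{x : G x ≠ G(x ⊕ eᵢ)} ≤ 2ⁿ · A^{d+2} B^{d+2} ℓ^d / log 2` with `ℓ = ACForm.logM (2s)`,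
`A = ACForm.cA = 8`, `B = ACForm.cB = 16 · 1056` (the tree's constants in Tal's Theorem 3.6). This is
Boppana's `I[f] = O((log s)^{d-1})`-type bound (Boppana 1997; Linial–Mansour–Nisan 1993) obtained
from A. Tal, *Tight bounds on the Fourier spectrum of AC⁰* (CCC 2017), Theorem 3.6, in the tree's
proved form `ACForm.tailWeight_le_tailBound` (`Literature/Computability/Complexity/ACFourierTails.lean`):

* flipping versus setting a bit: `G x ≠ G(x ⊕ eᵢ) ↔ G(x|ᵢ₌₀) ≠ G(x|ᵢ₌₁)` (`flip_ne_iff`);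
* the Fourier identity `Σ_i #{x : G x ≠ G(x ⊕ eᵢ)} = 2ⁿ Σ_S |S| ĝ(S)² = 2ⁿ Σ_{k<n} W^{≥k+1}[g]`,
  `g = sgn ∘ G` (O'Donnell 2014, Prop. 3.21, Parseval and Abel summation: the tree's
  `sum_tailWeight_piecewise`, `sum_cubeFourierCoeff_sq`, `sum_choose_mul_sq_eq_sum_tailWeight` of
  `FourierTails.lean` / `BooleanFourier.lean`) — `card_flip_eq_fourier`, `sum_card_flip_eq_sum_tailWeight`;
* Tal's tail bound `W^{≥k}[g] ≤ A^{d+2} a^k`, `a = exp(-log 2 / (B^{d+2} ℓ^d))`, for the layered formula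
  of `G` (`Circuit.exists_acForm`: height `≤ d + 2`, bottom fan-in `1`, effective size `≤ 2s`), summed
  geometrically (`sum_tailBound_succ_le`: `Σ_{k<n} a^{k+1} ≤ a/(1-a) ≤ B^{d+2} ℓ^d / log 2`).

Ported from `Summits/PneNP/PneNP/Theorems/OneSliceShallowSliceBoundInfluence.lean` (route OneSlice of
summit PneNP), restated for bit flips `x ⊕ eᵢ` instead of its `upPivotal` UP-edges. Consumed by the
lead's rung `stub_fewMaj`.
-/

set_option linter.dupNamespace false -- D-0017: single-problem summit ⇒ `QuantumAdvantage.QuantumAdvantage` by design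

noncomputable section

namespace Summit.QuantumAdvantage.QuantumAdvantage.Theorems.LiouvilleOrthogonalTC0

open Finset
open Literature.Computability.Complexity Literature.Computability.Complexity.LowDegree
open Literature.Probability.RandomGraphs.LowDegree (sgn sgn_true sgn_false)

namespace AcInfluence

-- adapted from Summits/PneNP/PneNP/Theorems/OneSliceShallowSliceBoundInfluence.lean

variable {m : ℕ}

/-! ### Flipping a bit versus setting it both ways -/

/-- Flipping bit `i` changes `G` at `x` iff setting bit `i` to `0` and to `1` give different values:
`G x ≠ G(x ⊕ eᵢ) ↔ G(x|ᵢ₌₀) ≠ G(x|ᵢ₌₁)`. -/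
theorem flip_ne_iff (G : (Fin m → Bool) → Bool) (i : Fin m) (x : Fin m → Bool) :
    G x ≠ G (Function.update x i (!x i)) ↔
      G (Function.update x i false) ≠ G (Function.update x i true) := by
  cases h : x i
  · have hx : Function.update x i false = x := by rw [← h]; exact Function.update_eq_self i x
    rw [hx, Bool.not_false]
  · have hx : Function.update x i true = x := by rw [← h]; exact Function.update_eq_self i x
    rw [hx, Bool.not_true]
    exact ne_comm

/-! ### The Fourier identity on `Fin m` -/

/-- The mean over the cube of a function of one coordinate: `Σ_x φ(x i) = 2^m · (φ 0 + φ 1)/2`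
(the bit flip `x ↦ x ⊕ eᵢ` is an involution of the cube exchanging `φ(x i)` and `φ(¬ x i)`). -/
theorem sum_apply_coord (i : Fin m) (φ : Bool → ℝ) :
    ∑ x : Fin m → Bool, φ (x i) = 2 ^ m * ((φ false + φ true) / 2) := by
  have hinv : Function.Involutive (fun x : Fin m → Bool => Function.update x i (!(x i))) := by
    intro x; funext j; by_cases hj : j = i
    · subst hj; simp
    · simp [hj]
  have e2 : ∑ x : Fin m → Bool, φ (x i) = ∑ x : Fin m → Bool, φ (!(x i)) := by
    rw [← Equiv.sum_comp hinv.toPerm (fun x => φ (!(x i)))]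
    refine Finset.sum_congr rfl fun x _ => ?_
    simp [Function.Involutive.toPerm]
  have e3 : ∑ x : Fin m → Bool, (φ (x i) + φ (!(x i))) = 2 ^ m * (φ false + φ true) := by
    have : ∀ x : Fin m → Bool, φ (x i) + φ (!(x i)) = φ false + φ true := by
      intro x; cases x i <;> simp [add_comm]
    simp only [this, Finset.sum_const, Finset.card_univ, Fintype.card_fun, Fintype.card_bool,
      Fintype.card_fin, nsmul_eq_mul, Nat.cast_pow, Nat.cast_ofNat]
  rw [Finset.sum_add_distrib, ← e2] at e3
  linarith

/-- The level-`≥ 1` Fourier weight of the restriction of `sgn ∘ G` fixing all coordinates but `i` to `β`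
is the indicator of "flipping bit `i` changes `G` at `β`" (Parseval for a function of one bit). -/
theorem tailWeight_one_piecewise (G : (Fin m → Bool) → Bool) (i : Fin m) (β : Fin m → Bool) :
    tailWeight (fun x : Fin m → Bool => sgn (G ((univ.erase i).piecewise β x))) 1 =
      if G β ≠ G (Function.update β i (!β i)) then 1 else 0 := by
  classical
  -- `(univ.erase i).piecewise β x = β` with coordinate `i` replaced by `x i`
  have hpw : (fun x : Fin m → Bool => sgn (G ((univ.erase i).piecewise β x))) =
      fun x => sgn (G (Function.update β i (x i))) := by
    funext x
    congr 2
    funext j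
    by_cases hj : j = i
    · subst hj
      simp [Finset.piecewise]
    · simp [Finset.piecewise, hj]
  rw [hpw]
  set h : (Fin m → Bool) → ℝ := fun x => sgn (G (Function.update β i (x i))) with hh
  have hsq : ∀ x, h x ^ 2 = 1 := fun x => by
    rw [hh]; dsimp only; cases G (Function.update β i (x i)) <;> simp
  -- split off the empty set
  have hsplit : tailWeight h 1 = (∑ S, cubeFourierCoeff h S ^ 2) - cubeFourierCoeff h ∅ ^ 2 := by
    rw [tailWeight]
    have : (univ.filter fun S : Finset (Fin m) => 1 ≤ S.card) = univ.erase ∅ := by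
      ext S; simp [Nat.one_le_iff_ne_zero, Finset.card_eq_zero]
    rw [this, Finset.sum_erase_eq_sub (Finset.mem_univ _)]
  rw [hsplit, sum_cubeFourierCoeff_sq, cubeFourierCoeff_empty]
  simp only [hsq, Finset.sum_const, Finset.card_univ, Fintype.card_fun, Fintype.card_bool, Fintype.card_fin,
    nsmul_eq_mul, mul_one, Nat.cast_pow, Nat.cast_ofNat]
  have h2m : (2 : ℝ) ^ m ≠ 0 := by positivity
  rw [div_self h2m]
  -- the mean of `h`
  set φ : Bool → ℝ := fun b => sgn (G (Function.update β i b)) with hφ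
  have hmean : ∑ x : Fin m → Bool, h x = 2 ^ m * ((φ false + φ true) / 2) := sum_apply_coord i φ
  rw [hmean, mul_div_cancel_left₀ _ h2m]
  by_cases hp : G (Function.update β i false) ≠ G (Function.update β i true)
  · rw [if_pos ((flip_ne_iff G i β).2 hp)]
    have : φ false + φ true = 0 := by
      rw [hφ]; dsimp only
      revert hp
      cases G (Function.update β i false) <;> cases G (Function.update β i true) <;> simp
    rw [this]; norm_num
  · rw [if_neg fun h' => hp ((flip_ne_iff G i β).1 h')]
    have heq : G (Function.update β i false) = G (Function.update β i true) := by
      by_contra hne; exact hp hne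
    have : ((φ false + φ true) / 2) ^ 2 = 1 := by
      rw [hφ]; dsimp only; rw [heq]
      cases G (Function.update β i true) <;> norm_num
    rw [this]; norm_num

/-- **Influence of one coordinate in Fourier terms**: `#{x : G x ≠ G(x ⊕ eᵢ)} = 2^m Σ_{S ∋ i} ĝ(S)²` for
`g = sgn ∘ G` (O'Donnell 2014, Prop. 3.21, and Parseval in the fixed coordinates: the tree's
`sum_tailWeight_piecewise` with the block `univ.erase i`). -/
theorem card_flip_eq_fourier (G : (Fin m → Bool) → Bool) (i : Fin m) :
    (#(univ.filter fun x : Fin m → Bool => G x ≠ G (Function.update x i (!x i))) : ℝ) =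
      2 ^ m * ∑ S ∈ univ.filter (fun S : Finset (Fin m) => i ∈ S),
        cubeFourierCoeff (fun x => sgn (G x)) S ^ 2 := by
  classical
  have key := sum_tailWeight_piecewise (fun x => sgn (G x)) (univ.erase i) 1
  have hL : ∑ β : Fin m → Bool, tailWeight (fun x => sgn (G ((univ.erase i).piecewise β x))) 1 =
      (#(univ.filter fun x : Fin m → Bool => G x ≠ G (Function.update x i (!x i))) : ℝ) := by
    simp only [tailWeight_one_piecewise]
    rw [Finset.sum_boole]
  have hR : (univ.filter fun S : Finset (Fin m) => 1 ≤ (S \ univ.erase i).card) =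
      univ.filter fun S : Finset (Fin m) => i ∈ S := by
    ext S
    simp only [Finset.mem_filter, Finset.mem_univ, true_and]
    have : S \ univ.erase i = S ∩ {i} := by
      ext j; by_cases hj : j = i <;> simp [hj]
    rw [this, Nat.one_le_iff_ne_zero, Ne, Finset.card_eq_zero, ← Ne, ← Finset.nonempty_iff_ne_empty]
    constructor
    · rintro ⟨j, hj⟩
      rw [Finset.mem_inter, Finset.mem_singleton] at hj
      exact hj.2 ▸ hj.1
    · intro h; exact ⟨i, Finset.mem_inter.2 ⟨h, Finset.mem_singleton_self i⟩⟩
  rw [hL, hR] at key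
  exact key

/-- **Total influence in Fourier terms**: `Σ_i #{x : G x ≠ G(x ⊕ eᵢ)} = 2^m Σ_S |S| ĝ(S)² = 2^m Σ_{d<m} W^{≥ d+1}[g]`,
`g = sgn ∘ G` (O'Donnell 2014, `I[f] = Σ_S |S| f̂(S)² = Σ_k W^{≥k}[f]`; Abel summation is the tree's
`sum_choose_mul_sq_eq_sum_tailWeight` at `k = 1`). -/
theorem sum_card_flip_eq_sum_tailWeight (G : (Fin m → Bool) → Bool) :
    ∑ i, (#(univ.filter fun x : Fin m → Bool => G x ≠ G (Function.update x i (!x i))) : ℝ) =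
      2 ^ m * ∑ d ∈ Finset.range m, tailWeight (fun x => sgn (G x)) (d + 1) := by
  classical
  set g : (Fin m → Bool) → ℝ := fun x => sgn (G x) with hg
  have habel := sum_choose_mul_sq_eq_sum_tailWeight g (le_refl 1)
  simp only [Nat.choose_one_right, Nat.sub_self, Nat.choose_zero_right, Nat.cast_one, one_mul] at habel
  rw [← habel]
  simp only [card_flip_eq_fourier, ← Finset.mul_sum]
  congr 1
  -- `Σ_i Σ_{S ∋ i} F S = Σ_S |S| F S`
  simp only [Finset.sum_filter]
  rw [Finset.sum_comm]
  refine Finset.sum_congr rfl fun S _ => ?_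
  rw [← Finset.sum_filter, Finset.filter_mem_eq_inter, Finset.univ_inter, Finset.sum_const, nsmul_eq_mul]

/-! ### The bound for shallow circuits -/

open ACForm

/-- A finite geometric tail: `Σ_{i<m} (e^{-c})^{i+1} ≤ 1/c` for `c > 0`
(`Σ_{i<m} a^{i+1} ≤ a/(1-a) = 1/(e^c - 1) ≤ 1/c`). -/
theorem sum_exp_neg_pow_succ_le {c : ℝ} (hc : 0 < c) (m : ℕ) :
    ∑ i ∈ Finset.range m, Real.exp (-c) ^ (i + 1) ≤ c⁻¹ := by
  set a := Real.exp (-c) with ha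
  have ha0 : 0 < a := Real.exp_pos _
  have ha1 : a < 1 := Real.exp_lt_one_iff.2 (by linarith)
  have htel : ∀ n : ℕ, (1 - a) * ∑ i ∈ Finset.range n, a ^ (i + 1) = a - a ^ (n + 1) := by
    intro n; induction n with
    | zero => simp
    | succ n ih => rw [Finset.sum_range_succ, mul_add, ih]; ring
  have hle : (1 - a) * ∑ i ∈ Finset.range m, a ^ (i + 1) ≤ a := by
    rw [htel]; linarith [pow_pos ha0 (m + 1)]
  have h1a : 0 < 1 - a := by linarith
  have hsum : ∑ i ∈ Finset.range m, a ^ (i + 1) ≤ a / (1 - a) := by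
    rw [le_div_iff₀ h1a]; linarith
  refine hsum.trans ?_
  -- `a/(1-a) = 1/(e^c - 1) ≤ 1/c`
  have hexp : a * Real.exp c = 1 := by rw [ha, ← Real.exp_add]; simp
  have hec : c + 1 ≤ Real.exp c := Real.add_one_le_exp c
  rw [← one_div, div_le_div_iff₀ h1a hc]
  nlinarith [mul_pos ha0 hc]

/-- **Tal's tail bounds summed geometrically**: for `ℓ ≥ 1`,
`Σ_{k<m} tailBound ℓ (d+2) 1 (k+1) ≤ A^{d+2} B^{d+2} ℓ^d / log 2`, since
`tailBound ℓ (d+2) 1 k = A^{d+2} a^k` with `a = exp(-log 2 / (B^{d+2} ℓ^d))` and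
`Σ_{k<m} a^{k+1} ≤ B^{d+2} ℓ^d / log 2` (`sum_exp_neg_pow_succ_le`). -/
theorem sum_tailBound_succ_le {ℓ : ℕ} (hℓ : 1 ≤ ℓ) (d m : ℕ) :
    ∑ i ∈ Finset.range m, tailBound ℓ (d + 2) 1 (i + 1) ≤
      (cA : ℝ) ^ (d + 2) * (cB : ℝ) ^ (d + 2) * (ℓ : ℝ) ^ d / Real.log 2 := by
  have hℓ1 : (1 : ℝ) ≤ ℓ := by exact_mod_cast hℓ
  set c : ℝ := Real.log 2 / ((cB : ℝ) ^ (d + 2) * 1 * (ℓ : ℝ) ^ (d + 2 - 2)) with hcdef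
  have hB : (0 : ℝ) < cB := by unfold cB B0; norm_num
  have hA : (0 : ℝ) < cA := by unfold cA; norm_num
  have hl2 := Real.log_pos (by norm_num : (1 : ℝ) < 2)
  have hden : 0 < (cB : ℝ) ^ (d + 2) * 1 * (ℓ : ℝ) ^ (d + 2 - 2) := by
    have : (0 : ℝ) < (ℓ : ℝ) ^ (d + 2 - 2) := pow_pos (by linarith) _
    positivity
  have hc : 0 < c := div_pos hl2 hden
  have hbound : ∀ k : ℕ, tailBound ℓ (d + 2) 1 k = (cA : ℝ) ^ (d + 2) * Real.exp (-c) ^ k := by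
    intro k
    rw [tailBound, ← Real.exp_nat_mul, hcdef]
    congr 2
    simp only [Nat.cast_one]
    ring
  calc ∑ i ∈ Finset.range m, tailBound ℓ (d + 2) 1 (i + 1)
      = (cA : ℝ) ^ (d + 2) * ∑ i ∈ Finset.range m, Real.exp (-c) ^ (i + 1) := by
        rw [Finset.mul_sum]
        exact Finset.sum_congr rfl fun i _ => hbound (i + 1)
    _ ≤ (cA : ℝ) ^ (d + 2) * c⁻¹ :=
        mul_le_mul_of_nonneg_left (sum_exp_neg_pow_succ_le hc m) (by positivity)
    _ = (cA : ℝ) ^ (d + 2) * (cB : ℝ) ^ (d + 2) * (ℓ : ℝ) ^ d / Real.log 2 := by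
        rw [hcdef, show d + 2 - 2 = d by omega]
        field_simp

/-- **Summed Fourier tails of a shallow circuit** (Boppana / Linial–Mansour–Nisan / Tal): for a circuit
over `acBasis` on `Fin m` of `acDepth ≤ d` and at most `s ≥ 1` gates,
`Σ_{k<m} W^{≥k+1}[sgn ∘ C] ≤ A^{d+2} B^{d+2} ℓ^d / log 2` with `ℓ = logM (2s)`, `A = cA`, `B = cB`
(Tal 2017, Theorem 3.6 = `ACForm.tailWeight_le_tailBound` for the layered formula `Circuit.exists_acForm`
of `C`: height `≤ d + 2`, bottom fan-in `1`, effective size `≤ 2s`; then `sum_tailBound_succ_le`). -/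
theorem sum_tailWeight_succ_le (C : Circuit (Fin m)) (hC : C.IsOver acBasis) {d s : ℕ}
    (hd : C.acDepth ≤ d) (hs : C.size ≤ s) (h1 : 1 ≤ s) :
    ∑ i ∈ Finset.range m, tailWeight (fun x => sgn (C.eval x)) (i + 1) ≤
      (cA : ℝ) ^ (d + 2) * (cB : ℝ) ^ (d + 2) * (logM (2 * s) : ℝ) ^ d / Real.log 2 := by
  obtain ⟨f, hev, hh, hw, hsize⟩ := C.exists_acForm hC
  have hM : 1 ≤ 2 * s := by omega
  have hℓ := one_le_logM hM
  have htail : ∀ k, tailWeight (fun x => sgn (C.eval x)) k ≤ tailBound (logM (2 * s)) (d + 2) 1 k := by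
    intro k
    have := tailWeight_le_tailBound (n := m) hM (d + 2) (by omega) f 1 le_rfl hℓ (by omega)
      (hsize.trans (by omega)) hw k
    have hfun : (fun x => sgn (C.eval x)) = sgnEval f := by funext x; rw [sgnEval, hev]
    rw [hfun]; exact this
  exact (Finset.sum_le_sum fun i _ => htail (i + 1)).trans (sum_tailBound_succ_le hℓ d m)

end AcInfluence

open AcInfluence in
/-- **Stub `stub_acInfluence` (line `Sketch`, v7) — total influence of a shallow circuit** (Boppana /
Linial–Mansour–Nisan via Tal's exponentially small Fourier tails, tree `ACForm.tailWeight_le_tailBound`):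
for a circuit over `acBasis` on `n` bits of `acDepth ≤ d` and `≤ s` gates (`s ≥ 1`), the number of pairs
(point, sensitive coordinate) is `≤ 2ⁿ · A^{d+2} B^{d+2} ℓ^d / log 2`, `ℓ = logM (2s)`, `A = ACForm.cA`,
`B = ACForm.cB`. Proof: `Σ_i #{x : G x ≠ G(x ⊕ eᵢ)} = 2ⁿ Σ_{k<n} W^{≥k+1}[sgn ∘ G]`
(`sum_card_flip_eq_sum_tailWeight`) and `sum_tailWeight_succ_le`. -/
theorem stub_acInfluence {n : ℕ} (G : Circuit (Fin n)) (hG : G.IsOver acBasis) {d s : ℕ}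
    (hd : G.acDepth ≤ d) (hs : G.size ≤ s) (h1 : 1 ≤ s) :
    ∑ i : Fin n, ((univ.filter fun x : Fin n → Bool =>
        G.eval x ≠ G.eval (Function.update x i (!x i))).card : ℝ)
      ≤ 2 ^ n * ((ACForm.cA : ℝ) ^ (d + 2) * (ACForm.cB : ℝ) ^ (d + 2) *
          (ACForm.logM (2 * s) : ℝ) ^ d / Real.log 2) := by
  rw [sum_card_flip_eq_sum_tailWeight]
  exact mul_le_mul_of_nonneg_left (sum_tailWeight_succ_le G hG hd hs h1) (by positivity)

end Summit.QuantumAdvantage.QuantumAdvantage.Theorems.LiouvilleOrthogonalTC0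

end
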